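import Mathlib
import HarnessLib
import Summits.Ventures.LatticeQCDFlow.Exactness.NCMCGeneralSpaceOccupancyVarianceFloorLemmas

/-!
# An EXPLICIT floor for the NCMC lane's integrated autocorrelation time: `τ_int(ρ_occ) ≥ σ ρ₀² / (2 (1 + ρ₀))` from prior-level regeneration with a REJECTED switch (`σ = σ(c − ΔF)` the stationary occupancy, `ρ₀ = ∫ (1 − F_c(x', Ω)) dm₀` the `m₀`-averaged forward rejection mass)

HONEST FRAMING: exact (Metropolis-corrected) sampling algorithms for lattice gauge theory;
figures of merit are autocorrelation/cost numbers at stated couplings and volumes; no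
continuum-physics claim.

Venture `LatticeQCDFlow` (cell pub-lqcd), topic `Exactness`; FANOUT row 13 (`eng-snf`, GEN-21).
NEW WORK of the cell, not a published result; no definition is introduced; nothing is cited as a
fact.  Setting of GEN-18's two-step certificate (`NCMCGeneralSpaceOccupancyChainDoeblin`): the
engine's iteration kernel `Q = switchKernel κF κR c W s e ∘ₖ levelKernel T₀ T₁` on `Bool × Ω`, level
samplers minorised uniformly (`m₀ ≤ T₀(x, ·)` for all `x`), positive rejected forward mass
`ρ₀ = ∫ (1 − F_c(x', Ω)) dm₀`.  The companion file `NCMCGeneralSpaceEventTauIntPositive` shows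
`τ_int(ρ_occ) > 0` qualitatively from ANY Doeblin power; THIS file gives a NUMBER for the lane, by an
argument that does not need two-valuedness: with `h` the bounded Poisson solution for the centred
occupancy `1_target − σ` and `σ²_occ = ∫ (Q(h²) − (Qh)²) dπ_c` (martingale form), restrict the outer
integral to the prior level (`π_c|prior = Z⁻¹ ν₀`) and the inner conditional variance at `(prior, x)`
to the branch "relax into `m₀`, then have the forward switch REJECTED" (GEN-18's
`rejPrior_le_iteration`: `((1 − F_c) m₀) ⊗ δ_prior ≤ Q((prior, x), ·)`), on which the chain sits at
`(prior, x')` and `h` takes the value `u(x') = h(prior, x')` while `Qh(prior, x) = u(x) + σ`: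
`σ²_occ ≥ Z⁻¹ ∫ dν₀(x) ∫ (u(x') − u(x) − σ)² d((1 − F_c) m₀)(x')`.  Since `(1 − F_c) m₀ ≤ m₀ ≤ π₀ = Z₀⁻¹ ν₀`
(uniform minorisation + invariance of `ν₀` under `T₀`), the elementary inequality
`∫_P ∫_A (u(x') − u(x) − t)² ≥ ρ² t² / (1 + ρ)` (`A ≤ P`, `ρ = A(Ω)`; the variance of `u` cancels
between the two terms) gives `σ²_occ ≥ (1 − σ) σ² ρ₀² / (1 + ρ₀)`, and `σ²_occ = 2 τ_int σ (1 − σ)`.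

## Content (lemmas in `NCMCGeneralSpaceOccupancyVarianceFloorLemmas`: the double-integral inequality,
## the prior level of `π_c`, the rejected branch of the conditional variance)

* **`CrooksPair.ncmc_tauInt_occupancy_ge_of_nHit`** — Crooks pair, `T₀, T₁` leaving `ν₀, ν₁`
  invariant, ANY Doeblin power `ε • ν ≤ (nHit Q m)(z, ·)` (for the Poisson solution), `m₀ ≤ T₀(x, ·)`
  for all `x`, `e^{−ΔF} = Z₁/Z₀`:
  `σ(c − ΔF) · ρ₀² / (2 (1 + ρ₀)) ≤ Scoring.tauInt (setACF Q π_c target)`,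
  `ρ₀ = (∫⁻ (1 − F_c(x', Ω)) dm₀).toReal`;
  **`CrooksPair.ncmc_tauInt_occupancy_ge`** — the same from GEN-18's own certificate
  (`m₀ ≤ T₀`, `m₁ ≤ T₁`, `ρ₀ ≠ 0`, `m₁ ≠ 0`), and **`CrooksPair.ncmc_tauInt_occupancy_pos`**.

NOT CLAIMED: sharpness (the two-state chain shows the order `σ ρ₀²` is not far off when the level
samplers mix in one step, but no optimality is asserted); the mirror bound through the target level
(identical argument, not typed); anything numerical.
-/

namespace Summit.Ventures.LatticeQCDFlow.Exactness.GeneralNCMC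

open MeasureTheory ProbabilityTheory Set Filter Finset
open scoped ENNReal NNReal Topology

/-! ## The floor for `τ_int(ρ_occ)` -/

section Floor

variable {Ω E : Type*} [MeasurableSpace Ω] [MeasurableSpace E]
  {ν₀ ν₁ : Measure Ω} [IsFiniteMeasure ν₀] [IsFiniteMeasure ν₁]
  {κF κR : Kernel Ω E} [IsMarkovKernel κF] [IsMarkovKernel κR] {s e : E → Ω} {W : E → ℝ} {c : ℝ}
  {T₀ T₁ : Kernel Ω Ω} [IsMarkovKernel T₀] [IsMarkovKernel T₁] {ε : ℝ≥0∞} {m : ℕ}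
  {ν : Measure (Bool × Ω)} [IsProbabilityMeasure ν]

/-- **THE EXPLICIT FLOOR FOR THE NCMC LANE'S `τ_int`, from any Doeblin power plus prior-level
regeneration.**  Crooks pair, level samplers leaving `ν₀, ν₁` invariant, `ε • ν ≤ (nHit Q m)(z, ·)`
for all `z` (`ε ≠ 0`, `0 < m` — only used for the Poisson solution), `m₀ ≤ T₀(x, ·)` for all `x`
(`m₀` finite), `e^{−ΔF} = Z₁/Z₀`.  With `σ = σ(c − ΔF)` and `ρ₀ = (∫⁻ (1 − F_c(x', Ω)) dm₀).toReal`: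
`σ ρ₀² / (2 (1 + ρ₀)) ≤ Scoring.tauInt (setACF Q π_c target)`. -/
theorem CrooksPair.ncmc_tauInt_occupancy_ge_of_nHit (h : CrooksPair ν₀ ν₁ κF κR s e W)
    (h0 : ν₀ univ ≠ 0) (h1 : ν₁ univ ≠ 0) (hT₀ : Kernel.Invariant T₀ ν₀)
    (hT₁ : Kernel.Invariant T₁ ν₁) (hε : ε ≠ 0) (hm : 0 < m)
    (hD : haveI := isMarkovKernel_switchKernel (κF := κF) (κR := κR) (c := c)
              h.measurable_W h.measurable_s h.measurable_e
      ∀ z, ε • ν ≤ nHit (switchKernel κF κR c W s e ∘ₖ levelKernel T₀ T₁) m z)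
    {m₀ : Measure Ω} [IsFiniteMeasure m₀] (hmin₀ : ∀ x, m₀ ≤ T₀ x)
    {ΔF : ℝ} (hΔF : Real.exp (-ΔF) = ((ν₀ univ)⁻¹ * ν₁ univ).toReal) :
    haveI := isMarkovKernel_switchKernel (κF := κF) (κR := κR) (c := c)
      h.measurable_W h.measurable_s h.measurable_e
    Real.sigmoid (c - ΔF) * (∫⁻ x', (1 - fwdFlow κF c W e x' univ) ∂m₀).toReal ^ 2
        / (2 * (1 + (∫⁻ x', (1 - fwdFlow κF c W e x' univ) ∂m₀).toReal))
      ≤ Scoring.tauInt (setACF (switchKernel κF κR c W s e ∘ₖ levelKernel T₀ T₁)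
          ((jointWeight c ν₀ ν₁ univ)⁻¹ • jointWeight c ν₀ ν₁) (targetLevel Ω)) := by
  haveI := isMarkovKernel_switchKernel (κF := κF) (κR := κR) (c := c)
    h.measurable_W h.measurable_s h.measurable_e
  haveI := isMarkovKernel_levelKernel T₀ T₁
  haveI := isProbabilityMeasure_jointLaw c ν₀ ν₁ h0
  haveI := isFiniteMeasure_jointWeight c ν₀ ν₁
  haveI : Nonempty (Bool × Ω) :=
    nonempty_of_isProbabilityMeasure ((jointWeight c ν₀ ν₁ univ)⁻¹ • jointWeight c ν₀ ν₁)
  set Q := switchKernel κF κR c W s e ∘ₖ levelKernel T₀ T₁ with hQ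
  set πc : Measure (Bool × Ω) := (jointWeight c ν₀ ν₁ univ)⁻¹ • jointWeight c ν₀ ν₁ with hπc
  set σ : ℝ := Real.sigmoid (c - ΔF) with hσdef
  -- the rejected-mass measure and its total mass `ρ`
  set A : Measure Ω := m₀.withDensity fun x' => 1 - fwdFlow κF c W e x' univ with hA
  have hAle : A ≤ m₀ := withDensity_rej_le m₀
  haveI : IsFiniteMeasure A := by
    refine ⟨lt_of_le_of_lt ?_ (measure_lt_top m₀ univ)⟩
    exact Measure.le_iff'.1 hAle univ
  have hAuniv : A univ = ∫⁻ x', (1 - fwdFlow κF c W e x' univ) ∂m₀ := withDensity_rej_univ m₀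
  set ρ : ℝ := (∫⁻ x', (1 - fwdFlow κF c W e x' univ) ∂m₀).toReal with hρdef
  have hρA : A.real univ = ρ := by rw [measureReal_def, hAuniv]
  have hρ0 : 0 ≤ ρ := ENNReal.toReal_nonneg
  -- stationary occupancy
  have hσ0 : 0 < σ := Real.sigmoid_pos _
  have hσ1 : σ < 1 := Real.sigmoid_lt_one _
  have hv0 : 0 < σ * (1 - σ) := mul_pos hσ0 (sub_pos.2 hσ1)
  have hπ : Kernel.Invariant Q πc := invariant_smul _ (iteration_invariant h hT₀ hT₁ c) _
  have hσeq : πc.real (targetLevel Ω) = σ := jointLaw_real_targetLevel c ν₀ ν₁ h0 h1 hΔF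
  have hp0 : 0 < πc.real (targetLevel Ω) := by rw [hσeq]; exact hσ0
  have hp1 : πc.real (targetLevel Ω) < 1 := by rw [hσeq]; exact hσ1
  -- Doeblin-power data
  have hε1 : ε ≤ 1 := by
    haveI := isMarkovKernel_nHit Q m
    exact eps_le_one_of_minorised hD
  have hε0 : 0 < ε := pos_iff_ne_zero.2 hε
  have hminS : ∀ z {B : Set (Bool × Ω)}, MeasurableSet B → ε * ν B ≤ nHit Q m z B :=
    fun z B hB => minorised_setwise hD z hB
  -- the occupancy indicator and its Poisson solution
  have hg : Measurable ((targetLevel Ω).indicator (1 : Bool × Ω → ℝ)) :=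
    measurable_one.indicator measurableSet_targetLevel
  have hgb : ∀ y, |(targetLevel Ω).indicator (1 : Bool × Ω → ℝ) y| ≤ 1 := fun y => by
    by_cases hy : y ∈ targetLevel Ω <;> simp [hy]
  have hmean : ∫ z, (targetLevel Ω).indicator (1 : Bool × Ω → ℝ) z ∂πc = σ := by
    rw [integral_indicator_one measurableSet_targetLevel, hσeq]
  obtain ⟨hfb, hCfb, hfb0⟩ := Scoring.centred_observable_bounds πc hg hgb
  obtain ⟨H, hHm, hHb, hpois⟩ := poisson_exists_of_nHit hminS hε0 hε1 hm hπ hfb hCfb hfb0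
  have hGK := integral_sq_sub_sq_kop_eq_greenKubo_of_nHit hminS hε0 hε1 hm hπ hfb hCfb hfb0
    hHm hHb hpois
  set CH : ℝ := 2 * (2 * 1) * (m : ℕ) / ε.toReal with hCH
  -- `σ²_occ = 2 τ σ (1 − σ)`
  have hσ2 : ∫ z, H z ^ 2 ∂πc - ∫ z, (Scoring.kop Q H z) ^ 2 ∂πc
      = 2 * Scoring.tauInt (setACF Q πc (targetLevel Ω)) * (σ * (1 - σ)) := by
    rw [hGK, ← hσeq, ← greenKubo_indicator_eq_tauInt hπ measurableSet_targetLevel hp0 hp1]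
    unfold Scoring.autocov
    rfl
  set τ : ℝ := Scoring.tauInt (setACF Q πc (targetLevel Ω)) with hτdef
  -- `Qh(prior, x) = u(x) + σ`
  have ha : ∀ x, Scoring.kop Q H (false, x) = H (false, x) + σ := by
    intro x
    have hx := hpois (false, x)
    rw [hmean, Set.indicator_of_notMem (by simp [targetLevel] : (false, x) ∉ targetLevel Ω)] at hx
    linarith only [hx]
  -- (i) `σ²_occ = ∫ q dπ_c`, `q = Q(H²) − (QH)² ≥ 0` bounded measurable
  obtain ⟨hKm, hKb⟩ := Scoring.iterate_kop_bounded_measurable Q hHm hHb 1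
  simp only [Function.iterate_one] at hKm hKb
  have hqm : Measurable fun z => Scoring.kop Q (fun y => H y ^ 2) z - (Scoring.kop Q H z) ^ 2 :=
    (Scoring.measurable_kop Q (hHm.pow_const 2)).sub (hKm.pow_const 2)
  have hqb : ∀ z, |Scoring.kop Q (fun y => H y ^ 2) z - (Scoring.kop Q H z) ^ 2| ≤ CH ^ 2 + CH ^ 2 :=
    fun z => (abs_sub _ _).trans (add_le_add
      (Scoring.abs_kop_le Q (fun y => by
        rw [abs_pow]; exact pow_le_pow_left₀ (abs_nonneg _) (hHb y) 2) z)
      (by rw [abs_pow]; exact pow_le_pow_left₀ (abs_nonneg _) (hKb z) 2))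
  have h_i : ∫ z, H z ^ 2 ∂πc - ∫ z, (Scoring.kop Q H z) ^ 2 ∂πc
      = ∫ z, (Scoring.kop Q (fun y => H y ^ 2) z - (Scoring.kop Q H z) ^ 2) ∂πc :=
    (integral_condVar_eq_sq_sub_sq_kop hπ hHm hHb).symm
  -- (ii) restrict to the prior level
  have h_ii := integral_jointLaw_ge_prior c ν₀ ν₁ hqm (fun z => condVar_nonneg hHm hHb z) hqb
  -- (iii) the rejected branch, pointwise in the prior state
  set u : Ω → ℝ := fun x => H (false, x) with hu
  have hum : Measurable u := hHm.comp measurable_prodMk_left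
  have hub : ∀ x, |u x| ≤ CH := fun x => hHb _
  have h_iii : ∀ x, ∫ x', (u x' - u x - σ) ^ 2 ∂A
      ≤ Scoring.kop Q (fun y => H y ^ 2) (false, x) - (Scoring.kop Q H (false, x)) ^ 2 := by
    intro x
    rw [kop_sq_sub_sq_eq_integral Q hHm hHb (false, x), ha x]
    have := integral_rejected_sq_le (κF := κF) (κR := κR) (c := c) (W := W) (s := s) (e := e)
      T₀ T₁ h.measurable_W h.measurable_s h.measurable_e (hmin₀ x) hHm hHb (H (false, x) + σ)
    refine le_trans (le_of_eq (integral_congr_ae (ae_of_all _ fun x' => ?_))) this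
    show (u x' - u x - σ) ^ 2 = (H (false, x') - (H (false, x) + σ)) ^ 2
    simp only [hu]; ring
  -- (iv) integrate (iii) over `ν₀`; the left side through the expansion of §1
  set P : Measure Ω := (ν₀ univ)⁻¹ • ν₀ with hP
  haveI : IsProbabilityMeasure P :=
    ⟨by rw [hP, Measure.smul_apply, smul_eq_mul, ENNReal.inv_mul_cancel h0 (measure_ne_top _ _)]⟩
  have hAP : A ≤ P := hAle.trans (le_normalised_of_minorised_invariant h0 hT₀ hmin₀)
  set b := ∫ x, u x ∂P with hb
  set J := ∫ x', (u x' - σ - b) ^ 2 ∂A with hJ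
  set B := ∫ x', (u x' - σ - b) ∂A with hB
  have hexpand : ∀ x, ∫ x', (u x' - u x - σ) ^ 2 ∂A
      = J - 2 * (u x - b) * B + A.real univ * (u x - b) ^ 2 :=
    fun x => integral_sq_shift_expand A hum hub σ b x
  have hFm : Measurable fun x => J - 2 * (u x - b) * B + A.real univ * (u x - b) ^ 2 :=
    ((measurable_const.sub (((hum.sub_const _).const_mul _).mul_const _)).add
      ((hum.sub_const _).pow_const 2 |>.const_mul _))
  have hbd' : ∀ x, |u x - b| ≤ CH + |b| := fun x =>
    (abs_sub _ _).trans (by linarith only [hub x])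
  have hFb : ∀ x, |J - 2 * (u x - b) * B + A.real univ * (u x - b) ^ 2|
      ≤ |J| + 2 * (CH + |b|) * |B| + A.real univ * (CH + |b|) ^ 2 := by
    intro x
    have h1' : |2 * (u x - b) * B| ≤ 2 * (CH + |b|) * |B| := by
      rw [abs_mul, abs_mul, abs_two]
      exact mul_le_mul_of_nonneg_right (mul_le_mul_of_nonneg_left (hbd' x) zero_le_two)
        (abs_nonneg _)
    have h2' : |A.real univ * (u x - b) ^ 2| ≤ A.real univ * (CH + |b|) ^ 2 := by
      rw [abs_mul, abs_of_nonneg (measureReal_nonneg), abs_pow]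
      exact mul_le_mul_of_nonneg_left (pow_le_pow_left₀ (abs_nonneg _) (hbd' x) 2) measureReal_nonneg
    calc |J - 2 * (u x - b) * B + A.real univ * (u x - b) ^ 2|
        ≤ |J - 2 * (u x - b) * B| + |A.real univ * (u x - b) ^ 2| := abs_add_le _ _
      _ ≤ |J| + |2 * (u x - b) * B| + |A.real univ * (u x - b) ^ 2| :=
          add_le_add (abs_sub _ _) le_rfl
      _ ≤ |J| + 2 * (CH + |b|) * |B| + A.real univ * (CH + |b|) ^ 2 := by
          linarith only [h1', h2']
  have h_iv : ∫ x, (J - 2 * (u x - b) * B + A.real univ * (u x - b) ^ 2) ∂ν₀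
      ≤ ∫ x, (Scoring.kop Q (fun y => H y ^ 2) (false, x) - (Scoring.kop Q H (false, x)) ^ 2) ∂ν₀ :=
    integral_mono (Scoring.integrable_of_bounded ν₀ hFm hFb)
      (Scoring.integrable_of_bounded ν₀ (hqm.comp measurable_prodMk_left) fun x => hqb _)
      fun x => by rw [← hexpand x]; exact h_iii x
  -- (v) the elementary inequality under `P`, transported to `ν₀ = Z₀ • P`
  have h_v := sq_mul_sq_le_integral_integral_sq_shift P A hAP hum hub σ
  simp_rw [hexpand] at h_v
  have hZ0 : ∫ x, (J - 2 * (u x - b) * B + A.real univ * (u x - b) ^ 2) ∂ν₀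
      = (ν₀ univ).toReal * ∫ x, (J - 2 * (u x - b) * B + A.real univ * (u x - b) ^ 2) ∂P := by
    rw [hP, integral_smul_measure, ENNReal.toReal_inv, smul_eq_mul, ← mul_assoc,
      mul_inv_cancel₀ (ENNReal.toReal_ne_zero.2 ⟨h0, measure_ne_top _ _⟩), one_mul]
  -- `Z⁻¹ Z₀ = 1 − σ`
  have hZZ : ((jointWeight c ν₀ ν₁ univ).toReal)⁻¹ * (ν₀ univ).toReal = 1 - σ := by
    have hc : πc.real (targetLevel Ω)ᶜ = 1 - σ := by
      rw [← hσeq]; exact probReal_compl_eq_one_sub measurableSet_targetLevel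
    rw [← hc, measureReal_def, hπc, Measure.smul_apply, smul_eq_mul, ENNReal.toReal_mul,
      ENNReal.toReal_inv, jointWeight_compl_targetLevel]
  -- assemble: `(1 − σ) σ² ρ² ≤ (1 + ρ) · 2 τ σ (1 − σ)`
  have hZinv : 0 ≤ ((jointWeight c ν₀ ν₁ univ).toReal)⁻¹ := inv_nonneg.2 ENNReal.toReal_nonneg
  have hmain : (1 - σ) * (ρ ^ 2 * σ ^ 2) ≤ (1 + ρ) * (2 * τ * (σ * (1 - σ))) := by
    rw [hρA] at h_v
    have step1 : (ν₀ univ).toReal * (ρ ^ 2 * σ ^ 2)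
        ≤ (1 + ρ) * ∫ x, (J - 2 * (u x - b) * B + ρ * (u x - b) ^ 2) ∂ν₀ := by
      rw [hρA] at hZ0
      rw [hZ0]
      have := mul_le_mul_of_nonneg_left h_v (ENNReal.toReal_nonneg : 0 ≤ (ν₀ univ).toReal)
      linarith only [this]
    have step2 : ((jointWeight c ν₀ ν₁ univ).toReal)⁻¹
          * ∫ x, (J - 2 * (u x - b) * B + ρ * (u x - b) ^ 2) ∂ν₀
        ≤ 2 * τ * (σ * (1 - σ)) := by
      rw [← hσ2, h_i]
      rw [hρA] at h_iv
      exact (mul_le_mul_of_nonneg_left h_iv hZinv).trans h_ii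
    calc (1 - σ) * (ρ ^ 2 * σ ^ 2)
        = ((jointWeight c ν₀ ν₁ univ).toReal)⁻¹ * ((ν₀ univ).toReal * (ρ ^ 2 * σ ^ 2)) := by
          rw [← hZZ]; ring
      _ ≤ ((jointWeight c ν₀ ν₁ univ).toReal)⁻¹
          * ((1 + ρ) * ∫ x, (J - 2 * (u x - b) * B + ρ * (u x - b) ^ 2) ∂ν₀) :=
          mul_le_mul_of_nonneg_left step1 hZinv
      _ = (1 + ρ) * (((jointWeight c ν₀ ν₁ univ).toReal)⁻¹
          * ∫ x, (J - 2 * (u x - b) * B + ρ * (u x - b) ^ 2) ∂ν₀) := by ring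
      _ ≤ (1 + ρ) * (2 * τ * (σ * (1 - σ))) :=
          mul_le_mul_of_nonneg_left step2 (by linarith only [hρ0])
  -- divide by `2 σ (1 − σ) (1 + ρ) > 0`
  have h2ρ : (0 : ℝ) < 2 * (1 + ρ) := by linarith only [hρ0]
  rw [div_le_iff₀ h2ρ]
  have hmain' : ρ ^ 2 * σ ≤ (1 + ρ) * (2 * τ) := by
    have h' : (σ * (1 - σ)) * (ρ ^ 2 * σ) ≤ (σ * (1 - σ)) * ((1 + ρ) * (2 * τ)) := by
      calc (σ * (1 - σ)) * (ρ ^ 2 * σ) = (1 - σ) * (ρ ^ 2 * σ ^ 2) := by ring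
        _ ≤ (1 + ρ) * (2 * τ * (σ * (1 - σ))) := hmain
        _ = (σ * (1 - σ)) * ((1 + ρ) * (2 * τ)) := by ring
    exact le_of_mul_le_mul_left h' hv0
  calc σ * ρ ^ 2 = ρ ^ 2 * σ := by ring
    _ ≤ (1 + ρ) * (2 * τ) := hmain'
    _ = τ * (2 * (1 + ρ)) := by ring

/-- **THE FLOOR FROM GEN-18's OWN CERTIFICATE.**  Crooks pair, `T₀, T₁` leaving `ν₀, ν₁` invariant,
`m₀ ≤ T₀(x, ·)` and `m₁ ≤ T₁(y, ·)` uniformly (`m₀` finite, `m₁ ≠ 0`), positive rejected forward mass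
`ρ₀ = ∫ (1 − F_c(x', Ω)) dm₀ ≠ 0`, `e^{−ΔF} = Z₁/Z₀`.  Then
`σ(c − ΔF) ρ₀² / (2 (1 + ρ₀)) ≤ τ_int(ρ_occ)`. -/
theorem CrooksPair.ncmc_tauInt_occupancy_ge (h : CrooksPair ν₀ ν₁ κF κR s e W)
    (h0 : ν₀ univ ≠ 0) (h1 : ν₁ univ ≠ 0) (hT₀ : Kernel.Invariant T₀ ν₀)
    (hT₁ : Kernel.Invariant T₁ ν₁) {m₀ m₁ : Measure Ω} [IsFiniteMeasure m₀]
    (hmin₀ : ∀ x, m₀ ≤ T₀ x) (hmin₁ : ∀ y, m₁ ≤ T₁ y)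
    (hρ : ∫⁻ x', (1 - fwdFlow κF c W e x' univ) ∂m₀ ≠ 0) (hm₁ : m₁ univ ≠ 0)
    {ΔF : ℝ} (hΔF : Real.exp (-ΔF) = ((ν₀ univ)⁻¹ * ν₁ univ).toReal) :
    haveI := isMarkovKernel_switchKernel (κF := κF) (κR := κR) (c := c)
      h.measurable_W h.measurable_s h.measurable_e
    Real.sigmoid (c - ΔF) * (∫⁻ x', (1 - fwdFlow κF c W e x' univ) ∂m₀).toReal ^ 2
        / (2 * (1 + (∫⁻ x', (1 - fwdFlow κF c W e x' univ) ∂m₀).toReal))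
      ≤ Scoring.tauInt (setACF (switchKernel κF κR c W s e ∘ₖ levelKernel T₀ T₁)
          ((jointWeight c ν₀ ν₁ univ)⁻¹ • jointWeight c ν₀ ν₁) (targetLevel Ω)) := by
  haveI := isMarkovKernel_switchKernel (κF := κF) (κR := κR) (c := c)
    h.measurable_W h.measurable_s h.measurable_e
  haveI := isMarkovKernel_levelKernel T₀ T₁
  haveI := isProbabilityMeasure_rejPrior_normalised (κF := κF) (c := c) (W := W) (e := e) hρ
  have hD := fun z => ncmc_sq_doeblin_prior (κR := κR) (s := s) (T₀ := T₀) (T₁ := T₁)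
    h.measurable_W h.measurable_s h.measurable_e hmin₀ hmin₁ hρ z
  have hε := ncmc_sq_doeblin_const_ne_zero (κR := κR) (s := s) (c := c) (e := e)
    h.measurable_W h.measurable_s hm₁ hρ
  have hD' : ∀ z, (min (∫⁻ x', (1 - fwdFlow κF c W e x' univ) ∂m₀)
        (∫⁻ y', revFlow κR c W s y' univ ∂m₁) * ∫⁻ x', (1 - fwdFlow κF c W e x' univ) ∂m₀) •
      ((∫⁻ x', (1 - fwdFlow κF c W e x' univ) ∂m₀)⁻¹ •
        (m₀.withDensity fun x' => 1 - fwdFlow κF c W e x' univ).map (Prod.mk false))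
      ≤ nHit (switchKernel κF κR c W s e ∘ₖ levelKernel T₀ T₁) 2 z := fun z => by
    rw [nHit_two]; exact hD z
  exact h.ncmc_tauInt_occupancy_ge_of_nHit h0 h1 hT₀ hT₁ hε (by norm_num : 0 < 2) hD' hmin₀ hΔF

/-- **Positivity for the lane from GEN-18's certificate**: `0 < τ_int(ρ_occ)`. -/
theorem CrooksPair.ncmc_tauInt_occupancy_pos (h : CrooksPair ν₀ ν₁ κF κR s e W)
    (h0 : ν₀ univ ≠ 0) (h1 : ν₁ univ ≠ 0) (hT₀ : Kernel.Invariant T₀ ν₀)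
    (hT₁ : Kernel.Invariant T₁ ν₁) {m₀ m₁ : Measure Ω} [IsFiniteMeasure m₀]
    (hmin₀ : ∀ x, m₀ ≤ T₀ x) (hmin₁ : ∀ y, m₁ ≤ T₁ y)
    (hρ : ∫⁻ x', (1 - fwdFlow κF c W e x' univ) ∂m₀ ≠ 0) (hm₁ : m₁ univ ≠ 0)
    {ΔF : ℝ} (hΔF : Real.exp (-ΔF) = ((ν₀ univ)⁻¹ * ν₁ univ).toReal) :
    haveI := isMarkovKernel_switchKernel (κF := κF) (κR := κR) (c := c)
      h.measurable_W h.measurable_s h.measurable_e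
    0 < Scoring.tauInt (setACF (switchKernel κF κR c W s e ∘ₖ levelKernel T₀ T₁)
          ((jointWeight c ν₀ ν₁ univ)⁻¹ • jointWeight c ν₀ ν₁) (targetLevel Ω)) := by
  have hle := h.ncmc_tauInt_occupancy_ge h0 h1 hT₀ hT₁ hmin₀ hmin₁ hρ hm₁ hΔF (T₀ := T₀) (T₁ := T₁)
  refine lt_of_lt_of_le ?_ hle
  have hρtop : ∫⁻ x', (1 - fwdFlow κF c W e x' univ) ∂m₀ ≠ ∞ :=
    ne_top_of_le_ne_top (measure_ne_top m₀ univ) (lintegral_rej_le m₀)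
  have hρpos : 0 < (∫⁻ x', (1 - fwdFlow κF c W e x' univ) ∂m₀).toReal :=
    ENNReal.toReal_pos hρ hρtop
  have hσ0 : 0 < Real.sigmoid (c - ΔF) := Real.sigmoid_pos _
  positivity

end Floor

end Summit.Ventures.LatticeQCDFlow.Exactness.GeneralNCMC
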